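import Literature.Topology.FourManifolds.BordismFourProjectivePlane
import Literature.Topology.FourManifolds.ComplexProjectiveSpaceHomologyProofs
import Literature.Topology.FourManifolds.ComplexProjectiveSpaceProofs
import Literature.AlgebraicTopology.SingularHomology.PoincareDualityProofs
import Literature.AlgebraicTopology.SingularHomology.OrientationCover
import Literature.AlgebraicTopology.SingularHomology.UniversalCoefficientsFree
import Literature.AlgebraicTopology.SingularHomology.LocalHomologyVanishing
import Literature.AlgebraicTopology.SingularHomology.CohomologyOfPoint
import Literature.AlgebraicTopology.SingularHomology.HomologySpheresProofs
import HarnessLib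

/-!
# The integral cohomology ring of `ℂℙⁿ`: powers of a generator of `H²` generate `H²ᵏ`

Topic `Literature/Topology/FourManifolds` (home of the tree's `ComplexProjectiveSpace n`).
A. Hatcher, *Algebraic Topology* (2002), Thm. 3.12 / Thm. 3.19: `H*(ℂPⁿ; ℤ) ≅ ℤ[α]/(αⁿ⁺¹)`,
`|α| = 2`; we follow the Poincaré-duality proof (Hatcher, proof of Cor. 3.39 ff. and Example 3.40
for `ℂPⁿ`: "by induction on `n` … the inclusion `ℂPⁿ⁻¹ ↪ ℂPⁿ` induces an isomorphism on `Hⁱ` for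
`i ≤ 2n - 2` … `α ⌣ αⁿ⁻¹` generates `H²ⁿ` since the cup product pairing is nonsingular"), and
D. Husemoller, *Fibre Bundles*, Ch. 17 §2 (2.3): the classes `1, a, …, aⁿ⁻¹` restrict to a base of
`H*(ℂPⁿ⁻¹)` — the fibre input of the Leray–Hirsch theorem for projective bundles (Thm. 2.5) and
hence of the uniqueness of Chern classes (Thm. 5.4).

For the tree's `ComplexProjectiveSpace n` (compact simply connected topological `2n`-manifold,
homology `Hᵢ ≅ ℤ` for even `i ≤ 2n` and `0` otherwise — all proved in the tree) we PROVE: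

* `cupPowL x k ∈ H²ᵏ(X; R)` — the `k`-th LEFT cup power `x ⌣ (x ⌣ ⋯)` of a degree-two class,
  `map_cupPowL`. (Siblings in the tree: `Literature.Geometry.ComplexAnalytic.cupPowL`
  (`SlopeStability.lean`, right recursion `κʲ ⌣ κ`, behind the Kähler / de Rham imports) and
  `Literature.AlgebraicGeometry.HodgeTheory.cupPowTwo` (`ℂ` coefficients); neither is in the import
  cone of `Topology/FourManifolds`, and the left recursion is the shape `a ⌣ b` of the adjunction
  `kroneckerPairing_cupProduct : ⟨a ⌣ b, c⟩ = ⟨b, a ⌢ c⟩` used in the top-degree step below — hence a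
  separately named copy `cupPowL`.)
* `ComplexProjectiveSpace.isZero_singularCohomology_int` — `Hⁱ(ℂℙⁿ; ℤ) = 0` for `i` odd or
  `i > 2n` (universal coefficients);
* `ComplexProjectiveSpace.hyperplaneIncl i : ℂℙⁿ → ℂℙⁿ⁺¹` and
  `bijective_singularCohomology_map_hyperplaneIncl` — **the hyperplane is an isomorphism on `Hʲ(-; ℤ)`
  for `1 ≤ j ≤ 2n`** (complement of a point of a `(2n+2)`-manifold, local homology, homotopy
  equivalence `ℂℙⁿ ≃ ℂℙⁿ⁺¹ ∖ pt`, Kronecker duality);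
* `ComplexProjectiveSpace.span_cupPowL_eq_top` — **if `x` generates `H²(ℂℙⁿ; ℤ)` (`n ≥ 1`) then
  `xᵏ` generates `H²ᵏ(ℂℙⁿ; ℤ)` for every `k ≤ n`** (induction on `n`; the top power by Poincaré
  duality `poincare_duality`, `⟨x ⌣ xⁿ⁻¹, [X]⟩ = ⟨xⁿ⁻¹, x ⌢ [X]⟩ = ±1`).

Everything is proved; no named facts. Related (different carrier): the same ring statement for the
complex points `ComplexPoints (projectiveSpace n ℂ)` of the scheme `ℙⁿ` is the tree's
`Motives.ComplexPoints.projectiveSpace_cupPowers_bijective_of_generator`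
(`AlgebraicGeometry/Motives/ProjectiveSpaceComplexPointsCohomology.lean`); here the carrier is the
topological manifold `ComplexProjectiveSpace n` of `Topology/FourManifolds`, the fibre model of the
tree's projective bundles. The vanishing `Hʲ⁺¹ = 0` from `Hⱼ₊₁ = 0`, `Hⱼ` free is the tree's
`isZero_singularCohomology_of_isZero_of_free` (`HomologySpheres.lean`), reused.

## References

* [HatcherAT2002] A. Hatcher, *Algebraic Topology*, CUP 2002, Thm. 3.12, Thm. 3.19, Cor. 3.39,
  Example 3.40; §3.1 Thm. 3.2 (universal coefficients); §3.3 Thm. 3.30 (Poincaré duality).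
* [HusemollerFibreBundles1994] D. Husemoller, *Fibre Bundles*, 3rd ed. (1994), Ch. 17 §2 (2.3),
  Thm. 2.5.
-/

noncomputable section

open CategoryTheory Limits Set Function
open Literature.AlgebraicTopology.SingularHomology

namespace Literature.Topology.FourManifolds

/-! ### Rank-one lattices: generators and unimodular values -/

section Algebra

variable {M : Type*} [AddCommGroup M] [Module ℤ M]

/-- In a `ℤ`-module `M ≅ ℤ`, `x` generates iff its coordinate is `±1`. [folklore] -/
theorem span_singleton_eq_top_iff_of_equiv (e : M ≃ₗ[ℤ] ℤ) (x : M) :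
    Submodule.span ℤ {x} = ⊤ ↔ (e x = 1 ∨ e x = -1) := by
  rw [← Int.isUnit_iff, ← Ideal.span_singleton_eq_top]
  change _ ↔ Submodule.span ℤ {e x} = ⊤
  constructor
  · intro h
    have h2 := congrArg (Submodule.map (e : M →ₗ[ℤ] ℤ)) h
    rw [Submodule.map_span, Set.image_singleton, Submodule.map_top, LinearMap.range_eq_top.2
      e.surjective] at h2
    exact h2
  · intro h
    have h2 := congrArg (Submodule.map (e.symm : ℤ →ₗ[ℤ] M)) h
    rw [Submodule.map_span, Set.image_singleton, Submodule.map_top, LinearMap.range_eq_top.2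
      e.symm.surjective] at h2
    simpa using h2

/-- A `ℤ`-linear self-map of `ℤ` is multiplication by its value at `1`. [folklore] -/
theorem int_linearMap_apply (g : ℤ →ₗ[ℤ] ℤ) (a : ℤ) : g a = a * g 1 := by
  have h := AddMonoidHom.apply_int (f := g.toAddMonoidHom) (n := a)
  rw [zsmul_eq_mul] at h
  exact h

/-- **A functional taking the value `±1` generates the dual of a rank-one lattice, and the element
generates the lattice.** [folklore] -/
theorem span_eq_top_of_apply_eq (e : M ≃ₗ[ℤ] ℤ) (φ : M →ₗ[ℤ] ℤ) (c : M)
    (h : φ c = 1 ∨ φ c = -1) :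
    Submodule.span ℤ {c} = ⊤ ∧ ∀ ψ : M →ₗ[ℤ] ℤ, ψ ∈ Submodule.span ℤ {φ} := by
  -- read everything in the coordinate `e`
  have key : ∀ (ψ : M →ₗ[ℤ] ℤ) (x : M), ψ x = e x * ψ (e.symm 1) := fun ψ x ↦ by
    have h1 : ψ x = (ψ.comp (e.symm : ℤ →ₗ[ℤ] M)) (e x) := by simp
    rw [h1, int_linearMap_apply]
    rfl
  have hunit : IsUnit (e c * φ (e.symm 1)) := by
    rw [← key, Int.isUnit_iff]
    exact h
  obtain ⟨hu1, hu2⟩ := IsUnit.mul_iff.1 hunit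
  refine ⟨(span_singleton_eq_top_iff_of_equiv e c).2 (Int.isUnit_iff.1 hu1), fun ψ ↦ ?_⟩
  obtain ⟨u, hu⟩ := hu2
  refine Submodule.mem_span_singleton.2 ⟨ψ (e.symm 1) * (u⁻¹ : ℤˣ), LinearMap.ext fun x ↦ ?_⟩
  rw [LinearMap.smul_apply, smul_eq_mul, key φ x, key ψ x, ← hu]
  have : ((u⁻¹ : ℤˣ) : ℤ) * (u : ℤ) = 1 := by simp
  linear_combination (e x * ψ (e.symm 1)) * this

/-- **A generator of the dual takes the value `±1` on a generator.** [folklore] -/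
theorem apply_eq_of_span_eq_top (e : M ≃ₗ[ℤ] ℤ) {g : M} (hg : Submodule.span ℤ {g} = ⊤)
    {φ : M →ₗ[ℤ] ℤ} (hφ : ∀ ψ : M →ₗ[ℤ] ℤ, ψ ∈ Submodule.span ℤ {φ}) : φ g = 1 ∨ φ g = -1 := by
  obtain ⟨a, ha⟩ := Submodule.mem_span_singleton.1 (hφ (e : M →ₗ[ℤ] ℤ))
  have h1 : e g = a * φ g := by
    have := LinearMap.congr_fun ha g
    rw [LinearMap.smul_apply, smul_eq_mul] at this
    exact this.symm
  have hunit : IsUnit (e g) := Int.isUnit_iff.2 ((span_singleton_eq_top_iff_of_equiv e g).1 hg)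
  rw [h1] at hunit
  exact Int.isUnit_iff.1 (IsUnit.mul_iff.1 hunit).2

/-- Transport of generation along a linear equivalence. [folklore] -/
theorem span_singleton_eq_top_of_equiv {N : Type*} [AddCommGroup N] [Module ℤ N]
    (f : M ≃ₗ[ℤ] N) {x : M} (hx : Submodule.span ℤ {x} = ⊤) : Submodule.span ℤ {f x} = ⊤ := by
  have h2 := congrArg (Submodule.map (f : M →ₗ[ℤ] N)) hx
  rwa [Submodule.map_span, Set.image_singleton, Submodule.map_top, LinearMap.range_eq_top.2
    f.surjective] at h2

end Algebra

/-! ### Cup powers of a degree-two class -/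

section CupPow

universe u v

variable {R : Type v} [CommRing R] {X Y : Type u} [TopologicalSpace X] [TopologicalSpace Y]

/-- The `k`-th **left cup power** `xᵏ ∈ H²ᵏ(X; R)` of a class `x ∈ H²(X; R)`: `x⁰ = 1`,
`xᵏ⁺¹ = x ⌣ xᵏ` (see the module docstring for the right-recursion siblings
`Geometry.ComplexAnalytic.cupPow`, `HodgeTheory.cupPowTwo` and why this copy exists).
[cite: HatcherAT2002, §3.2 (cup product), Thm. 3.12] -/
def cupPowL (x : singularCohomology R R X 2) : (k : ℕ) → singularCohomology R R X (2 * k)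
  | 0 => singularCohomology.one R X
  | k + 1 => cupProduct (by omega) x (cupPowL x k)

/-- `x⁰ = 1`. [folklore] -/
@[simp]
theorem cupPowL_zero (x : singularCohomology R R X 2) : cupPowL x 0 = singularCohomology.one R X := rfl

/-- `xᵏ⁺¹ = x ⌣ xᵏ`. [folklore] -/
theorem cupPowL_succ (x : singularCohomology R R X 2) (k : ℕ) :
    cupPowL x (k + 1) = cupProduct (by omega) x (cupPowL x k) := rfl

/-- `x¹ = x`. [folklore] -/
theorem cupPowL_one (x : singularCohomology R R X 2) : cupPowL x 1 = x := by
  rw [cupPowL_succ, cupPowL_zero]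
  exact cupProduct_one x

/-- Cup powers are natural: `f*(xᵏ) = (f* x)ᵏ`. [cite: HatcherAT2002, Prop. 3.10] -/
theorem map_cupPowL (f : C(X, Y)) (x : singularCohomology R R Y 2) (k : ℕ) :
    singularCohomology.map R R f (2 * k) (cupPowL x k) = cupPowL (singularCohomology.map R R f 2 x) k := by
  induction k with
  | zero => exact singularCohomology.map_one f
  | succ k ih => rw [cupPowL_succ, cupPowL_succ, cupProduct_map, ih]

end CupPow

/-! ### Kronecker duality: cohomology isomorphisms from homology isomorphisms -/

section Kronecker

variable {X Y : Type} [TopologicalSpace X] [TopologicalSpace Y]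

/-- **A map inducing an isomorphism on `Hₖ₊₁(-; ℤ)` induces one on `Hᵏ⁺¹(-; ℤ)`, when `Hₖ` of
both spaces is free** (the Kronecker maps are then bijective, Hatcher Thm. 3.2, and natural).
[cite: HatcherAT2002, §3.1 Thm. 3.2 and p. 201 (naturality)] -/
theorem bijective_singularCohomology_map_of_isIso (f : C(X, Y)) (k : ℕ)
    [Module.Free ℤ (singularHomology ℤ ℤ X k)] [Module.Free ℤ (singularHomology ℤ ℤ Y k)]
    [IsIso (singularHomology.map ℤ ℤ f (k + 1))] :
    Function.Bijective (singularCohomology.map ℤ ℤ f (k + 1)) := by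
  have hX := kroneckerPairing_bijective_of_free ℤ X k
  have hY := kroneckerPairing_bijective_of_free ℤ Y k
  let F : singularHomology ℤ ℤ X (k + 1) ≃ₗ[ℤ] singularHomology ℤ ℤ Y (k + 1) :=
    (asIso (singularHomology.map ℤ ℤ f (k + 1))).toLinearEquiv
  have hF : ∀ c, F c = singularHomology.map ℤ ℤ f (k + 1) c := fun _ ↦ rfl
  constructor
  · intro a b hab
    apply hY.1
    refine LinearMap.ext fun c ↦ ?_
    obtain ⟨c', rfl⟩ := F.surjective c
    rw [hF, ← kroneckerPairing_map, ← kroneckerPairing_map, hab]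
  · intro b
    let ψ : singularHomology ℤ ℤ Y (k + 1) →ₗ[ℤ] ℤ :=
      (kroneckerPairing ℤ ℤ X (k + 1) b).comp (F.symm : _ →ₗ[ℤ] _)
    obtain ⟨a, ha⟩ := hY.2 ψ
    refine ⟨a, hX.1 (LinearMap.ext fun c ↦ ?_)⟩
    rw [kroneckerPairing_map, ha]
    change kroneckerPairing ℤ ℤ X (k + 1) b (F.symm (F c)) = _
    rw [LinearEquiv.symm_apply_apply]

/-- `Hᵏ⁺¹(X; ℤ) ≃ Hom(Hₖ₊₁(X; ℤ), ℤ)` when `Hₖ(X; ℤ)` is free (universal coefficients with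
vanishing `Ext`). [cite: HatcherAT2002, §3.1 Thm. 3.2] -/
def kroneckerEquivOfFree (k : ℕ) [Module.Free ℤ (singularHomology ℤ ℤ X k)] :
    singularCohomology ℤ ℤ X (k + 1) ≃ₗ[ℤ] (singularHomology ℤ ℤ X (k + 1) →ₗ[ℤ] ℤ) :=
  LinearEquiv.ofBijective (kroneckerPairing ℤ ℤ X (k + 1)) (kroneckerPairing_bijective_of_free ℤ X k)

/-- `kroneckerEquivOfFree` is the Kronecker pairing. [folklore] -/
@[simp]
theorem kroneckerEquiv_apply (k : ℕ) [Module.Free ℤ (singularHomology ℤ ℤ X k)]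
    (a : singularCohomology ℤ ℤ X (k + 1)) : kroneckerEquivOfFree k a = kroneckerPairing ℤ ℤ X (k + 1) a :=
  rfl

/-- The Kronecker map `Hᵈ(X; ℤ) → Hom(H_d(X; ℤ), ℤ)` is bijective in every positive degree when
all homology groups of `X` are free. [cite: HatcherAT2002, §3.1 Thm. 3.2] -/
theorem bijective_kroneckerPairing_of_pos [h : ∀ j, Module.Free ℤ (singularHomology ℤ ℤ X j)]
    {d : ℕ} (hd : 0 < d) : Function.Bijective (kroneckerPairing ℤ ℤ X d) := by
  obtain ⟨k, rfl⟩ : ∃ k, d = k + 1 := ⟨d - 1, by omega⟩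
  exact kroneckerPairing_bijective_of_free ℤ X k

/-- **Generators correspond under Kronecker duality**: if `y` generates `Hᵈ(X; ℤ)` (`d > 0`, all
homology free), every functional on `H_d(X; ℤ)` is a multiple of `⟨y, -⟩`. [cite: HatcherAT2002, §3.1 Thm. 3.2] -/
theorem mem_span_kroneckerPairing [h : ∀ j, Module.Free ℤ (singularHomology ℤ ℤ X j)]
    {d : ℕ} (hd : 0 < d) {y : singularCohomology ℤ ℤ X d} (hy : Submodule.span ℤ {y} = ⊤)
    (ψ : singularHomology ℤ ℤ X d →ₗ[ℤ] ℤ) : ψ ∈ Submodule.span ℤ {kroneckerPairing ℤ ℤ X d y} := by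
  obtain ⟨a', ha'⟩ := (bijective_kroneckerPairing_of_pos hd).2 ψ
  have hmem : a' ∈ Submodule.span ℤ {y} := by rw [hy]; trivial
  obtain ⟨a, rfl⟩ := Submodule.mem_span_singleton.1 hmem
  exact Submodule.mem_span_singleton.2 ⟨a, by rw [← ha', map_smulₛₗ, RingHom.id_apply]⟩

/-- Conversely, if every functional on `H_d(X; ℤ)` is a multiple of `⟨z, -⟩` then `z` generates
`Hᵈ(X; ℤ)` (`d > 0`, all homology free). [cite: HatcherAT2002, §3.1 Thm. 3.2] -/
theorem span_eq_top_of_forall_mem_span [h : ∀ j, Module.Free ℤ (singularHomology ℤ ℤ X j)]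
    {d : ℕ} (hd : 0 < d) {z : singularCohomology ℤ ℤ X d}
    (hz : ∀ ψ : singularHomology ℤ ℤ X d →ₗ[ℤ] ℤ, ψ ∈ Submodule.span ℤ {kroneckerPairing ℤ ℤ X d z}) :
    Submodule.span ℤ {z} = ⊤ := by
  have hK := bijective_kroneckerPairing_of_pos (X := X) hd
  rw [Submodule.eq_top_iff']
  intro w
  obtain ⟨a, ha⟩ := Submodule.mem_span_singleton.1 (hz (kroneckerPairing ℤ ℤ X d w))
  refine Submodule.mem_span_singleton.2 ⟨a, hK.1 ?_⟩
  rw [map_smulₛₗ, RingHom.id_apply]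
  exact ha

/-- **A map inducing an isomorphism on `H_d(-; ℤ)` induces one on `Hᵈ(-; ℤ)`** in every positive
degree, when all homology groups of both spaces are free. [cite: HatcherAT2002, §3.1 Thm. 3.2 and p. 201] -/
theorem bijective_singularCohomology_map_of_isIso_pos (f : C(X, Y)) {d : ℕ} (hd : 0 < d)
    [hX : ∀ j, Module.Free ℤ (singularHomology ℤ ℤ X j)] [hY : ∀ j, Module.Free ℤ (singularHomology ℤ ℤ Y j)]
    [IsIso (singularHomology.map ℤ ℤ f d)] :
    Function.Bijective (singularCohomology.map ℤ ℤ f d) := by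
  obtain ⟨k, rfl⟩ : ∃ k, d = k + 1 := ⟨d - 1, by omega⟩
  exact bijective_singularCohomology_map_of_isIso f k

end Kronecker

/-! ### `ℂℙⁿ`: homology lattices, cohomology vanishing, the hyperplane -/

namespace ComplexProjectiveSpace

variable {n : ℕ}

/-- `Hⱼ(ℂℙⁿ; ℤ) ≅ ℤ` for `j` even, `j ≤ 2n` (the tree's computation, as a linear equivalence).
[cite: HatcherAT2002, §2.2 p. 140] -/
theorem nonempty_singularHomology_equiv_int {j : ℕ} (hj : Even j ∧ j ≤ 2 * n) :
    Nonempty (singularHomology ℤ ℤ (ComplexProjectiveSpace n) j ≃ₗ[ℤ] ℤ) := by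
  obtain ⟨e⟩ := (singularHomology_complexProjectiveSpace_of_module ℤ ℤ n j).1 hj
  exact ⟨e.toLinearEquiv.trans ULift.moduleEquiv⟩

/-- `Hⱼ(ℂℙⁿ; ℤ) = 0` unless `j` is even and `j ≤ 2n`. [cite: HatcherAT2002, §2.2 p. 140] -/
theorem isZero_singularHomology_int {j : ℕ} (hj : ¬(Even j ∧ j ≤ 2 * n)) :
    IsZero (singularHomology ℤ ℤ (ComplexProjectiveSpace n) j) :=
  (singularHomology_complexProjectiveSpace_of_module ℤ ℤ n j).2 hj

/-- Every `Hⱼ(ℂℙⁿ; ℤ)` is a free `ℤ`-module (it is `ℤ` or `0`). [cite: HatcherAT2002, §2.2 p. 140] -/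
instance free_singularHomology (n j : ℕ) : Module.Free ℤ (singularHomology ℤ ℤ (ComplexProjectiveSpace n) j) := by
  by_cases hj : Even j ∧ j ≤ 2 * n
  · obtain ⟨e⟩ := nonempty_singularHomology_equiv_int hj
    exact Module.Free.of_equiv e.symm
  · haveI := ModuleCat.subsingleton_of_isZero (isZero_singularHomology_int hj)
    infer_instance

/-- **`Hⁱ(ℂℙⁿ; ℤ) = 0` for `i` odd or `i > 2n`** (universal coefficients: `Hⁱ ≅ Hom(Hᵢ, ℤ)` as all
`Hᵢ₋₁` are free). [cite: HatcherAT2002, Thm. 3.12 (additive structure) with §3.1 Thm. 3.2] -/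
theorem isZero_singularCohomology_int {i : ℕ} (hi : ¬(Even i ∧ i ≤ 2 * n)) :
    IsZero (singularCohomology ℤ ℤ (ComplexProjectiveSpace n) i) := by
  obtain ⟨k, rfl⟩ : ∃ k, i = k + 1 := by
    refine ⟨i - 1, ?_⟩
    have : i ≠ 0 := by rintro rfl; exact hi ⟨⟨0, rfl⟩, Nat.zero_le _⟩
    omega
  exact isZero_singularCohomology_of_isZero_of_free (injective_kroneckerMap_of_free_holds ℤ _ k)
    inferInstance (isZero_singularHomology_int hi)

/-- **`Hⁱ(ℂℙⁿ; ℤ) ≅ Hom(Hᵢ(ℂℙⁿ; ℤ), ℤ) ≅ ℤ`-line for `i ≥ 1` even, `i ≤ 2n`**: a linear equivalence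
with `ℤ`. [cite: HatcherAT2002, Thm. 3.12 with §3.1 Thm. 3.2] -/
theorem nonempty_singularCohomology_equiv_int {k : ℕ} (hk : Even (k + 1) ∧ k + 1 ≤ 2 * n) :
    Nonempty (singularCohomology ℤ ℤ (ComplexProjectiveSpace n) (k + 1) ≃ₗ[ℤ] ℤ) := by
  obtain ⟨e⟩ := nonempty_singularHomology_equiv_int hk
  -- `Hom(H, ℤ) ≅ Hom(ℤ, ℤ) ≅ ℤ`
  exact ⟨(kroneckerEquivOfFree k).trans (e.symm.dualMap.trans (LinearMap.ringLmapEquivSelf ℤ ℤ ℤ))⟩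

/-! #### The hyperplane `ℂℙⁿ ↪ ℂℙⁿ⁺¹` -/

/-- The hyperplane inclusion `ℂℙⁿ → ℂℙⁿ⁺¹` omitting the `i`-th coordinate point (the tree's
`hyperplaneEmbMap` followed by the inclusion of the punctured space). [cite: HatcherAT2002, Example 0.6] -/
def hyperplaneIncl (i : Fin (n + 1 + 1)) : C(ComplexProjectiveSpace n, ComplexProjectiveSpace (n + 1)) :=
  (subsetIncl ({center i}ᶜ : Set (ComplexProjectiveSpace (n + 1)))).comp (hyperplaneEmbMap i)

variable (R : Type) [CommRing R] (M : Type) [AddCommGroup M] [Module R M]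

/-- **Removing a point of `ℂℙⁿ⁺¹` does not change `Hⱼ` for `j ≤ 2n`**: the relative groups
`Hⱼ(ℂℙⁿ⁺¹, ℂℙⁿ⁺¹ ∖ pt)` are local homology groups of a `(2n+2)`-manifold, zero for `j ≠ 2n + 2`.
[cite: HatcherAT2002, §3.3 p. 231 (local homology of a manifold) and Thm. 2.13 ff.] -/
theorem isIso_singularHomology_map_subsetIncl_compl_center (i : Fin (n + 1 + 1)) {j : ℕ}
    (hj : j ≤ 2 * n) :
    IsIso (singularHomology.map R M
      (subsetIncl ({center i}ᶜ : Set (ComplexProjectiveSpace (n + 1)))) j) := by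
  have hloc := isZero_localHomology_holds R M (ComplexProjectiveSpace (n + 1)) (n := 2 * (n + 1))
  refine isIso_map_subsetIncl_of_isZero R M ?_ ?_
  · exact hloc (center i) (by omega)
  · exact hloc (center i) (by omega)

/-- **The hyperplane `ℂℙⁿ ↪ ℂℙⁿ⁺¹` is an isomorphism on `Hⱼ` for `j ≤ 2n`** (it is a homotopy
equivalence onto the punctured space, `homotopyEquivComplCenter`). [cite: HatcherAT2002, Example 0.6, §2.2 p. 140] -/
theorem isIso_singularHomology_map_hyperplaneIncl (i : Fin (n + 1 + 1)) {j : ℕ} (hj : j ≤ 2 * n) :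
    IsIso (singularHomology.map R M (hyperplaneIncl i) j) := by
  haveI := isIso_singularHomology_map_subsetIncl_compl_center R M i hj
  haveI : IsIso (singularHomology.map R M (hyperplaneEmbMap (n := n) i) j) :=
    (inferInstance : IsIso (singularHomology.isoOfHomotopyEquiv R M (homotopyEquivComplCenter i) j).hom)
  rw [hyperplaneIncl, singularHomology.map_comp]
  infer_instance

/-- **The hyperplane `ℂℙⁿ ↪ ℂℙⁿ⁺¹` is an isomorphism on `Hʲ(-; ℤ)` for `1 ≤ j ≤ 2n`** (Hatcher,
Example 3.40 / proof of Thm. 3.19 for `ℂPⁿ`: "the inclusion `ℂPⁿ⁻¹ ↪ ℂPⁿ` induces an isomorphism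
on `Hⁱ` for `i ≤ 2n - 2`"). [cite: HatcherAT2002, Thm. 3.19 / Example 3.40] -/
theorem bijective_singularCohomology_map_hyperplaneIncl (i : Fin (n + 1 + 1)) {d : ℕ}
    (hd : 0 < d) (hdn : d ≤ 2 * n) :
    Function.Bijective (singularCohomology.map ℤ ℤ (hyperplaneIncl i) d) := by
  haveI := isIso_singularHomology_map_hyperplaneIncl ℤ ℤ i hdn
  exact bijective_singularCohomology_map_of_isIso_pos (hyperplaneIncl i) hd

/-! ### The cohomology ring -/

/-- `1` generates `H⁰(ℂℙⁿ; ℤ)` (path connected). [cite: HatcherAT2002, §3.1 p. 199] -/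
theorem span_one_eq_top : Submodule.span ℤ {singularCohomology.one ℤ (ComplexProjectiveSpace n)} = ⊤ := by
  haveI : SimplyConnectedSpace (ComplexProjectiveSpace n) := simplyConnectedSpace_complexProjectiveSpace_holds n
  let e := singularCohomologyZeroEquiv ℤ ℤ (ComplexProjectiveSpace n)
  refine (span_singleton_eq_top_iff_of_equiv e _).2 (Or.inl ?_)
  rw [singularCohomology.one, singularCohomologyZeroEquiv_π, singularCochainComplex.cocyclesZeroEquiv_apply,
    singularCochainComplex.iCocycles_mk]
  rfl

/-- A `ℤ`-orientation of `ℂℙⁿ` in the homological sense (simply connected manifolds are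
orientable). [cite: HatcherAT2002, §3.3 Prop. 3.25] -/
theorem nonempty_homologicalOrientation (n : ℕ) :
    Nonempty (HomologicalOrientation ℤ (ComplexProjectiveSpace n) (2 * n)) := by
  haveI : SimplyConnectedSpace (ComplexProjectiveSpace n) := simplyConnectedSpace_complexProjectiveSpace_holds n
  exact isOrientableOver_of_simplyConnectedSpace (R := ℤ) (ComplexProjectiveSpace n)

/-- **The top step**: on `X = ℂℙᵐ⁺¹` (`m ≥ 1`), if `x` generates `H²(X; ℤ)` and `xᵐ`
generates `H²ᵐ(X; ℤ)`, then `xᵐ⁺¹` generates `H²ᵐ⁺²(X; ℤ)` — Poincaré duality: `x ⌢ [X]`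
generates `H₂ₘ`, so `⟨xᵐ⁺¹, [X]⟩ = ⟨xᵐ, x ⌢ [X]⟩ = ±1`. [cite: HatcherAT2002, Cor. 3.39 / Example 3.40] -/
theorem span_cupPowL_top {m : ℕ} (hm0 : 0 < m) (x : singularCohomology ℤ ℤ (ComplexProjectiveSpace (m + 1)) 2)
    (hx : Submodule.span ℤ {x} = ⊤) (hm : Submodule.span ℤ {cupPowL x m} = ⊤) :
    Submodule.span ℤ {cupPowL x (m + 1)} = ⊤ := by
  obtain ⟨μ⟩ := nonempty_homologicalOrientation (m + 1)
  obtain ⟨e₂⟩ := nonempty_singularHomology_equiv_int (n := m + 1) (j := 2 * m)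
    ⟨⟨m, by ring⟩, by omega⟩
  obtain ⟨eTop⟩ := nonempty_singularHomology_equiv_int (n := m + 1) (j := 2 * (m + 1))
    ⟨⟨m + 1, by ring⟩, le_rfl⟩
  have h2 : 2 + 2 * m = 2 * (m + 1) := by ring
  -- `D : H² → H₂ₘ`, `x ↦ x ⌢ [X]`, is bijective, so `x ⌢ [X]` generates `H₂ₘ`
  let D : singularCohomology ℤ ℤ (ComplexProjectiveSpace (m + 1)) 2 ≃ₗ[ℤ]
      singularHomology ℤ ℤ (ComplexProjectiveSpace (m + 1)) (2 * m) :=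
    LinearEquiv.ofBijective (poincareDualityMap μ h2) (poincare_duality μ h2)
  have hgen : Submodule.span ℤ {capProduct h2 x μ.fundamentalClass} = ⊤ :=
    span_singleton_eq_top_of_equiv D hx
  -- `xᵐ` generates `H²ᵐ ≅ Hom(H₂ₘ, ℤ)`, so `⟨xᵐ, x ⌢ [X]⟩ = ±1`
  have hval := apply_eq_of_span_eq_top e₂ hgen
    (mem_span_kroneckerPairing (by omega : 0 < 2 * m) hm)
  -- `⟨xᵐ⁺¹, [X]⟩ = ⟨x ⌣ xᵐ, [X]⟩ = ⟨xᵐ, x ⌢ [X]⟩ = ±1`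
  have hval' : kroneckerPairing ℤ ℤ _ (2 * (m + 1)) (cupPowL x (m + 1)) μ.fundamentalClass = 1 ∨
      kroneckerPairing ℤ ℤ _ (2 * (m + 1)) (cupPowL x (m + 1)) μ.fundamentalClass = -1 := by
    rw [cupPowL_succ, kroneckerPairing_cupProduct]
    exact hval
  -- conclude by Kronecker duality in the top degree
  exact span_eq_top_of_forall_mem_span (by omega : 0 < 2 * (m + 1))
    (span_eq_top_of_apply_eq eTop _ _ hval').2

/-- **The cohomology ring of `ℂℙⁿ`**: if `x` generates `H²(ℂℙⁿ; ℤ)` then `xᵏ` generates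
`H²ᵏ(ℂℙⁿ; ℤ)` for every `k ≤ n` (Hatcher Thm. 3.12 / 3.19: `H*(ℂPⁿ; ℤ) = ℤ[α]/(αⁿ⁺¹)`;
Husemoller Ch. 17 (2.3): `1, a, …, aⁿ` is a base). Induction on `n`: below the top degree through
the hyperplane `ℂℙⁿ⁻¹ ↪ ℂℙⁿ`, in the top degree by Poincaré duality (`span_cupPowL_top`).
[cite: HatcherAT2002, Thm. 3.19 / Example 3.40] [cite: HusemollerFibreBundles1994, Ch. 17 §2 (2.3)] -/
theorem span_cupPowL_eq_top : ∀ (n : ℕ) (x : singularCohomology ℤ ℤ (ComplexProjectiveSpace n) 2),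
    Submodule.span ℤ {x} = ⊤ → ∀ {k : ℕ}, k ≤ n → Submodule.span ℤ {cupPowL x k} = ⊤ := by
  intro n
  induction n with
  | zero =>
    intro x _ k hk
    obtain rfl : k = 0 := Nat.le_zero.1 hk
    exact span_one_eq_top
  | succ n ih =>
    intro x hx k hk
    -- below the top: through the hyperplane
    have hlow : ∀ {k : ℕ}, 1 ≤ k → k ≤ n → Submodule.span ℤ {cupPowL x k} = ⊤ := by
      intro k hk1 hkn
      have hr2 := bijective_singularCohomology_map_hyperplaneIncl (n := n) 0 (d := 2) two_pos (by omega)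
      have hr := bijective_singularCohomology_map_hyperplaneIncl (n := n) 0 (d := 2 * k) (by omega) (by omega)
      let r2 := LinearEquiv.ofBijective _ hr2
      let r := LinearEquiv.ofBijective _ hr
      have hx' : Submodule.span ℤ {singularCohomology.map ℤ ℤ (hyperplaneIncl (n := n) 0) 2 x} = ⊤ :=
        span_singleton_eq_top_of_equiv r2 hx
      have hih := ih _ hx' hkn
      rw [← map_cupPowL] at hih
      -- pull back along the bijection in degree `2k`
      have := span_singleton_eq_top_of_equiv r.symm hih
      rwa [show r.symm (singularCohomology.map ℤ ℤ (hyperplaneIncl (n := n) 0) (2 * k) (cupPowL x k)) =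
        cupPowL x k from r.symm_apply_apply (cupPowL x k)] at this
    rcases Nat.eq_zero_or_pos k with rfl | hk1
    · exact span_one_eq_top
    rcases Nat.lt_or_ge k (n + 1) with hkn | hkn
    · exact hlow hk1 (by omega)
    obtain rfl : k = n + 1 := le_antisymm hk hkn
    rcases Nat.eq_zero_or_pos n with rfl | hn
    · rw [cupPowL_one]; exact hx
    exact span_cupPowL_top hn x hx (hlow hn le_rfl)

end ComplexProjectiveSpace

end Literature.Topology.FourManifolds
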